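import Mathlib.MeasureTheory.Integral.Pi
import Literature.Probability.LatticeModels.LayeredPlaneRotatorSlabReduction
import Literature.Probability.LatticeModels.PlaneRotatorChainTwoPoint
import HarnessLib

/-!
# The exact leaf-transfer identity for plane rotators, and Lieb's reduction of the box number `S_R`
# (shell-free box) to two-point functions of the free block

E. H. Lieb, *A refinement of Simon's correlation inequality*, Comm. Math. Phys. **77** (1980) 127–135 [Lieb1980],
Theorem 4 and p. 128, p. 133 of the proof ("It is immaterial whether the `B` spins are connected together … the
two-spin system consisting of `a` and `b` alone, `⟨σ_a·σ_b⟩ = I₁(β)/I₀(β)`", eq. (25)); J. Ginibre, Comm. Math. Phys.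
**16** (1970) 310, Example 4 (plane rotators; free ends). Vocabulary of `PlaneRotatorGinibreComparison.lean`
(`twoPoint J a b = ⟨cos(θ_a − θ_b)⟩_{V,J}`, couplings on ORDERED pairs, inverse temperature absorbed) and of
`LayeredPlaneRotatorDecoupling.lean` (a block `L ⊆ V`, a foot map `foot : V → V` sending `V ∖ L` into `L`, the shear
`shear L foot`, `leafOf`, `leafField`; block couplings `J` supported in `L × L`, DANGLING couplings `D` supported on the
bonds `{foot v, v}`, `v ∉ L`).

* `twoPoint_add_leaf_transfer` — **the exact leaf-transfer identity**: for `a ∈ L` and a leaf `v ∉ L`,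

    `⟨cos(θ_a − θ_v)⟩_{J+D} = u(K_v) · ⟨cos(θ_a − θ_{foot v})⟩_J`,  `K_v = D(foot v, v) + D(v, foot v)`, `u = I₁/I₀`

  (tree `PlaneRotator.besselRatio`). This is the equality case behind the tree's leaf BOUND `twoPoint_add_leaf_le`
  (local Ward inequality, `u(K) ≤ K/2`) and extends `twoPoint_add_leaf_eq` (both sites in the block) to block–leaf
  pairs; a leaf with no bond (`K_v = 0`, a free rotator) has `u(0) = 0`. Proof: under the Haar-measure-preserving shear
  `θ_v ↦ θ_v θ_{foot v}` the weight factorises into the block weight and `∏_w e^{K_w cos θ_w}` over the leaves, and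
  `cos(θ_a − θ_v) ↦ cos(θ_a − θ_{foot v}) cos θ_v + sin(θ_a − θ_{foot v}) sin θ_v`; the block and leaf coordinates are
  independent, `∫ sin θ_v ∏ e^{K_w cos θ_w} dθ = 0` by the inversion symmetry of the torus, and
  `∫ cos θ_v ∏_w e^{K_w cos θ_w} / ∫ ∏_w e^{K_w cos θ_w} = I₁(K_v)/I₀(K_v)` (Fubini over the sites, eq. (25)).
* `pullIn R`, `footIn R` — the foot map of the box `[−(R+1), R+1]^ν`: coordinates `±(R+1)` are pulled to `±R`. For the
  nearest-neighbour model the reference inside system of the box of radius `R + 1` (shell–shell bonds removed,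
  `refCoupling`) is the free BLOCK `[−R, R]^ν` plus dangling bonds: a shell site on a face hangs on its pulled-in
  neighbour, all other shell sites (edges, corners) are free rotators (`eq_pullIn_of_l1Norm_eq_one`).
* `nnBoxShellSum_succ` — **Lieb's number of the box of radius `R + 1` from the block of radius `R`**:

    `S_{R+1}(K) = u(K) · ∑_{b ∈ shell, b on a face} ⟨cos(θ_0 − θ_{foot b})⟩_{[−R,R]^ν, K, free}`,

  the two-point functions on the right being those of the nearest-neighbour XY model on the finite box `box ν R` with
  free boundary conditions (`nnXYCoupling K ν (box ν R)`). For `ν = 2`, `R + 1 = 2`: the twelve face sites of the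
  `5 × 5` box hang on the eight boundary sites of the `3 × 3` block (edge midpoints once, corners twice), the four
  corners of the `5 × 5` box are free, so `S_2(K) = u(K)·(4G_e + 8G_c)` with `G_e = ⟨cos(θ_0 − θ_{(1,0)})⟩_{3×3}`,
  `G_c = ⟨cos(θ_0 − θ_{(1,1)})⟩_{3×3}` (by the lattice symmetry of the block) — the reduction used for the certified
  `R = 2` number of the `hubbard-tc` cell (K5-LIEB-BOX-R2: `S_2(0.663) < 1 < S_2(0.664)`, `T_c^{XY}(ℤ²) ≤ 1.5083 J`).
* `boxInteriorSum_succ` — the interior susceptibility of the reference box of radius `R + 1` is the susceptibility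
  of the centre in the free block: `χ^{int}_{R+1}(K) = ∑_{x ∈ [−R,R]²} ⟨cos(θ_0 − θ_x)⟩_{[−R,R]², K, free}`
  (`twoPoint_add_leaf_eq`: the shell leaves do not change block correlations).

Cell use (`pub/hubbard-tc`, MO-S3, K5-Lieb column): the inputs `S_R`, `χ^{int}_R` of the kernel criteria
`twoPoint_nn_le_pow_boxShellSum`, `slabShellSum_le_box2D`, `twoPoint_layered_le_pow_box2D` are, by a KERNEL identity,
finite sums of two-point functions of ONE free block — the objects a certified character-expansion / quadrature
engine encloses; no hand reduction remains between the kernel criterion and the certified enclosure. Classical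
effective model only (K5); no `T_c` object; no numerics here.
-/

noncomputable section

open MeasureTheory Filter Finset ProbabilityTheory
open scoped BigOperators ComplexConjugate

namespace Literature.Probability.LatticeModels

namespace PlaneRotator

/-! ### Torus tools: independence of coordinate blocks, the shear, inversion -/

section Tools

variable {V : Type*} [Fintype V] [DecidableEq V] {L : Finset V} {foot : V → V}

variable [MeasurableSpace Circle] [BorelSpace Circle]

omit [Fintype V] [BorelSpace Circle] in
/-- `blockExtend L` is measurable. [folklore] -/
private theorem measurable_blockExtend (L : Finset V) : Measurable (blockExtend L) := by
  refine measurable_pi_lambda _ fun v => ?_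
  by_cases h : v ∈ L
  · simp only [blockExtend, dif_pos h]; exact measurable_pi_apply _
  · simp only [blockExtend, dif_neg h]; exact measurable_const

omit [DecidableEq V] in
/-- The coordinates of the torus `U(1)^V` are independent under the Haar probability measure. [folklore] -/
private theorem iIndepFun_apply : iIndepFun (fun (v : V) (θ : V → Circle) => θ v) (torusHaar V) :=
  iIndepFun_pi (μ := fun _ : V => Measure.haarMeasure (⊤ : TopologicalSpace.PositiveCompacts Circle))
    (X := fun (_ : V) (z : Circle) => z) fun _ => aemeasurable_id'

/-- **Independence of disjoint coordinate blocks** (as in `LayeredPlaneRotatorDecoupling.lean`, where it is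
private): `∫ F·G dθ = ∫ F dθ · ∫ G dθ` if `F` depends on the coordinates in `L` and `G` on those outside `L`.
[folklore] -/
private theorem integral_mul_eq_mul_of_dependsOn (L : Finset V) {F G : (V → Circle) → ℝ} (hF : Continuous F)
    (hG : Continuous G) (hFdep : ∀ θ θ' : V → Circle, (∀ v ∈ L, θ v = θ' v) → F θ = F θ')
    (hGdep : ∀ θ θ' : V → Circle, (∀ v ∉ L, θ v = θ' v) → G θ = G θ') :
    ∫ θ, F θ * G θ ∂torusHaar V = (∫ θ, F θ ∂torusHaar V) * ∫ θ, G θ ∂torusHaar V := by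
  set F' : (L → Circle) → ℝ := fun ψ => F (blockExtend L ψ) with hF'
  set G' : ((Lᶜ : Finset V) → Circle) → ℝ := fun ψ => G (blockExtend Lᶜ ψ) with hG'
  have hFF : F = F' ∘ fun (θ : V → Circle) (i : L) => θ i := by
    funext θ
    exact hFdep θ _ fun v hv => by simp [blockExtend, hv]
  have hGG : G = G' ∘ fun (θ : V → Circle) (j : (Lᶜ : Finset V)) => θ j := by
    funext θ
    exact hGdep θ _ fun v hv => by simp [blockExtend, Finset.mem_compl, hv]
  have hind : IndepFun (fun (θ : V → Circle) (i : L) => θ i) (fun θ (j : (Lᶜ : Finset V)) => θ j)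
      (torusHaar V) :=
    iIndepFun_apply.indepFun_finset L Lᶜ disjoint_compl_right fun v => measurable_pi_apply v
  have hmF' : Measurable F' := hF.measurable.comp (measurable_blockExtend L)
  have hmG' : Measurable G' := hG.measurable.comp (measurable_blockExtend Lᶜ)
  have hind' := hind.comp hmF' hmG'
  have h1 : AEStronglyMeasurable (F' ∘ fun (θ : V → Circle) (i : L) => θ i) (torusHaar V) := by
    rw [← hFF]; exact hF.aestronglyMeasurable
  have h2 : AEStronglyMeasurable (G' ∘ fun (θ : V → Circle) (j : (Lᶜ : Finset V)) => θ j) (torusHaar V) := by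
    rw [← hGG]; exact hG.aestronglyMeasurable
  rw [hFF, hGG]
  exact hind'.integral_fun_mul_eq_mul_integral h1 h2

omit [Fintype V] [MeasurableSpace Circle] [BorelSpace Circle] in
/-- `shear θ v = θ v` on the block. [folklore] -/
private theorem shear_of_mem (θ : V → Circle) {v : V} (hv : v ∈ L) : shear L foot θ v = θ v := if_pos hv

omit [Fintype V] [MeasurableSpace Circle] [BorelSpace Circle] in
/-- `shear θ v = θ v · θ (foot v)` off the block. [folklore] -/
private theorem shear_of_not_mem (θ : V → Circle) {v : V} (hv : v ∉ L) :
    shear L foot θ v = θ v * θ (foot v) := if_neg hv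

omit [Fintype V] [MeasurableSpace Circle] [BorelSpace Circle] in
/-- The shear is continuous. [folklore] -/
private theorem continuous_shear (L : Finset V) (foot : V → V) : Continuous (shear L foot) := by
  refine continuous_pi fun v => ?_
  by_cases hv : v ∈ L
  · simp only [shear, MonoidHom.coe_mk, OneHom.coe_mk, if_pos hv]
    exact continuous_apply v
  · simp only [shear, MonoidHom.coe_mk, OneHom.coe_mk, if_neg hv]
    exact (continuous_apply v).mul (continuous_apply (foot v))

omit [Fintype V] [MeasurableSpace Circle] [BorelSpace Circle] in
/-- The shear is onto when `foot` maps the complement of `L` into `L`. [folklore] -/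
private theorem shear_surjective (hfoot : ∀ v, v ∉ L → foot v ∈ L) : Function.Surjective (shear L foot) := by
  intro θ'
  refine ⟨fun v => if v ∈ L then θ' v else θ' v * (θ' (foot v))⁻¹, funext fun v => ?_⟩
  by_cases hv : v ∈ L
  · simp [shear, hv]
  · have hf := hfoot v hv
    simp [shear, hv, hf]

/-- Change of variables under the (Haar-measure preserving) shear. [folklore] -/
private theorem integral_comp_shear (hfoot : ∀ v, v ∉ L → foot v ∈ L) {g : (V → Circle) → ℝ} (hg : Continuous g) :
    ∫ θ, g (shear L foot θ) ∂torusHaar V = ∫ θ, g θ ∂torusHaar V := by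
  have h : MeasurePreserving (shear L foot) (torusHaar V) (torusHaar V) :=
    MonoidHom.measurePreserving (continuous_shear L foot) (shear_surjective hfoot) rfl
  calc ∫ θ, g (shear L foot θ) ∂torusHaar V = ∫ θ, g θ ∂((torusHaar V).map (shear L foot)) :=
        (integral_map h.measurable.aemeasurable hg.aestronglyMeasurable).symm
    _ = ∫ θ, g θ ∂torusHaar V := by rw [h.map_eq]

omit [DecidableEq V] in
/-- Change of variables under inversion `θ ↦ θ⁻¹` of the torus (a continuous surjective endomorphism of the compact
abelian group, hence Haar-measure preserving). [folklore] -/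
private theorem integral_comp_inv {g : (V → Circle) → ℝ} (hg : Continuous g) :
    ∫ θ, g θ⁻¹ ∂torusHaar V = ∫ θ, g θ ∂torusHaar V := by
  have h : MeasurePreserving (invMonoidHom : (V → Circle) →* (V → Circle)) (torusHaar V) (torusHaar V) :=
    MonoidHom.measurePreserving continuous_inv inv_surjective rfl
  calc ∫ θ, g θ⁻¹ ∂torusHaar V = ∫ θ, g θ ∂((torusHaar V).map (invMonoidHom : (V → Circle) →* (V → Circle))) :=
        (integral_map h.measurable.aemeasurable hg.aestronglyMeasurable).symm
    _ = ∫ θ, g θ ∂torusHaar V := by rw [h.map_eq]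

end Tools

/-! ### The exact leaf-transfer identity -/

section LeafTransfer

variable {V : Type*} [Fintype V] [DecidableEq V] {L : Finset V} {foot : V → V} {J D : V × V → ℝ}

/-- The total dangling coupling hanging at a site `w`: `K_w = ∑_{p : leaf(p) = w} D_p` (for a leaf `v ∉ L` this is
`D(foot v, v) + D(v, foot v)`, `leafCoupling_eq`). [folklore] -/
private def leafCoupling (L : Finset V) (D : V × V → ℝ) (w : V) : ℝ :=
  ∑ p ∈ Finset.univ.filter (fun p : V × V => leafOf L p = w), D p

/-- The leaf field is a single-site field: `∑_p D_p cos θ_{leaf(p)} = ∑_w K_w cos θ_w`. [folklore] -/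
private theorem leafField_eq_sum_leafCoupling (L : Finset V) (D : V × V → ℝ) (θ : V → Circle) :
    leafField L D θ = ∑ w, leafCoupling L D w * ((θ w : Circle) : ℂ).re := by
  unfold leafField leafCoupling
  rw [← Finset.sum_fiberwise Finset.univ (leafOf L) (fun p : V × V => D p * ((θ (leafOf L p) : Circle) : ℂ).re)]
  refine Finset.sum_congr rfl fun w _ => ?_
  rw [Finset.sum_mul]
  refine Finset.sum_congr rfl fun p hp => ?_
  rw [(Finset.mem_filter.1 hp).2]

/-- For a leaf `v ∉ L` the dangling coupling at `v` is `K_v = D(foot v, v) + D(v, foot v)` (the two orientations of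
its bond to the foot; every other dangling bond has another leaf). [folklore] -/
private theorem leafCoupling_eq (hfoot : ∀ v, v ∉ L → foot v ∈ L)
    (hD : ∀ p, D p ≠ 0 → (p.1 ∉ L ∧ p.2 = foot p.1) ∨ (p.2 ∉ L ∧ p.1 = foot p.2)) {v : V} (hv : v ∉ L) :
    leafCoupling L D v = D (foot v, v) + D (v, foot v) := by
  have hfv : foot v ≠ v := fun h => hv (h ▸ hfoot v hv)
  have hne : ((foot v, v) : V × V) ≠ (v, foot v) := fun h => hfv (Prod.mk.inj h).1
  have hl1 : leafOf L (foot v, v) = v := by rw [leafOf, if_neg hv]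
  have hl2 : leafOf L (v, foot v) = v := by rw [leafOf, if_pos (hfoot v hv)]
  unfold leafCoupling
  refine Finset.sum_eq_add (foot v, v) (v, foot v) hne (fun c hc hcne => ?_)
    (fun h => (h (Finset.mem_filter.2 ⟨Finset.mem_univ _, hl1⟩)).elim)
    (fun h => (h (Finset.mem_filter.2 ⟨Finset.mem_univ _, hl2⟩)).elim)
  have hlc : leafOf L c = v := (Finset.mem_filter.1 hc).2
  by_contra hDc
  obtain ⟨x, y⟩ := c
  rcases hD _ hDc with ⟨h1, h2⟩ | ⟨h2, h1⟩
  · simp only at h1 h2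
    have hl : leafOf L (x, y) = x := by rw [leafOf]; exact if_pos (h2 ▸ hfoot _ h1)
    rw [hl] at hlc
    subst hlc
    exact hcne.2 (by rw [h2])
  · simp only at h1 h2
    have hl : leafOf L (x, y) = y := by rw [leafOf]; exact if_neg h2
    rw [hl] at hlc
    subst hlc
    exact hcne.1 (by rw [h1])

/-- The relative-angle SINE `sin(θ_b − θ_a) = Im(θ̄_a θ_b)` (companion of `cosDiff`). [folklore] -/
def sinDiff (a b : V) (θ : V → Circle) : ℝ :=
  (conj ((θ a : Circle) : ℂ) * θ b).im

omit [Fintype V] [DecidableEq V] in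
/-- `sinDiff` is continuous. [folklore] -/
private theorem continuous_sinDiff (a b : V) : Continuous (sinDiff a b : (V → Circle) → ℝ) := by
  unfold sinDiff; fun_prop

omit [Fintype V] in
/-- The observable under the shear: for `a ∈ L` and a leaf `v ∉ L`,
`cos(θ_a − θ_vθ_{fv}) = cos(θ_a − θ_{fv}) cos θ_v^{rel} − sin(θ_a − θ_{fv}) sin θ_v^{rel}` — in characters,
`Re(θ̄_a θ_{fv} θ_v) = Re(θ̄_a θ_{fv}) Re θ_v − Im(θ̄_a θ_{fv}) Im θ_v`. [folklore] -/
private theorem cosDiff_shear_leaf (θ : V → Circle) {a v : V} (ha : a ∈ L) (hv : v ∉ L) :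
    cosDiff a v (shear L foot θ) =
      cosDiff a (foot v) θ * ((θ v : Circle) : ℂ).re - sinDiff a (foot v) θ * ((θ v : Circle) : ℂ).im := by
  unfold cosDiff sinDiff
  rw [shear_of_mem θ ha, shear_of_not_mem θ hv, Circle.coe_mul]
  have h : conj ((θ a : Circle) : ℂ) * ((θ v : ℂ) * (θ (foot v) : ℂ)) =
      (conj ((θ a : Circle) : ℂ) * (θ (foot v) : ℂ)) * (θ v : ℂ) := by ring
  rw [h, Complex.mul_re]

omit [Fintype V] in
/-- A block Hamiltonian (couplings supported in `L × L`) is shear-invariant. [folklore] -/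
private theorem ginibreHamiltonian_shear_of_supported (hJ : ∀ p, J p ≠ 0 → p.1 ∈ L ∧ p.2 ∈ L)
    [Fintype V] (θ : V → Circle) :
    ginibreHamiltonian (pairChars V) J (shear L foot θ) = ginibreHamiltonian (pairChars V) J θ := by
  unfold ginibreHamiltonian
  refine Finset.sum_congr rfl fun p _ => ?_
  by_cases hJp : J p = 0
  · rw [hJp, zero_mul, zero_mul]
  rw [pairChars_apply, reChar, reChar, diffChar_apply, diffChar_apply, shear_of_mem θ (hJ p hJp).1,
    shear_of_mem θ (hJ p hJp).2]

/-- The dangling-bond Hamiltonian of the sheared configuration is the leaf field. [folklore] -/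
private theorem ginibreHamiltonian_leaf_shear (hfoot : ∀ v, v ∉ L → foot v ∈ L)
    (hD : ∀ p, D p ≠ 0 → (p.1 ∉ L ∧ p.2 = foot p.1) ∨ (p.2 ∉ L ∧ p.1 = foot p.2)) (θ : V → Circle) :
    ginibreHamiltonian (pairChars V) D (shear L foot θ) = leafField L D θ := by
  unfold ginibreHamiltonian leafField
  refine Finset.sum_congr rfl fun p _ => ?_
  by_cases hDp : D p = 0
  · rw [hDp, zero_mul, zero_mul]
  congr 1
  rw [pairChars_apply, reChar, diffChar_apply]
  obtain ⟨x, y⟩ := p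
  rcases hD _ hDp with ⟨h1, h2⟩ | ⟨h2, h1⟩
  · simp only at h1 h2
    have hl : leafOf L (x, y) = x := by rw [leafOf]; exact if_pos (h2 ▸ hfoot _ h1)
    rw [hl]
    simp only
    rw [h2, shear_of_not_mem θ h1, shear_of_mem θ (hfoot _ h1), mul_inv, mul_assoc, inv_mul_cancel, mul_one,
      Circle.coe_inv_eq_conj, Complex.conj_re]
  · simp only at h1 h2
    have hl : leafOf L (x, y) = y := by rw [leafOf]; exact if_neg h2
    rw [hl]
    simp only
    rw [h1, shear_of_mem θ (hfoot _ h2), shear_of_not_mem θ h2, mul_comm (θ y), ← mul_assoc, inv_mul_cancel,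
      one_mul]

/-- The total weight of the sheared configuration: block weight times the leaf-field weight. [folklore] -/
private theorem ginibreWeight_add_shear (hfoot : ∀ v, v ∉ L → foot v ∈ L) (hJ : ∀ p, J p ≠ 0 → p.1 ∈ L ∧ p.2 ∈ L)
    (hD : ∀ p, D p ≠ 0 → (p.1 ∉ L ∧ p.2 = foot p.1) ∨ (p.2 ∉ L ∧ p.1 = foot p.2)) (θ : V → Circle) :
    ginibreWeight (pairChars V) (J + D) (shear L foot θ) =
      ginibreWeight (pairChars V) J θ * Real.exp (leafField L D θ) := by
  rw [ginibreWeight_add]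
  unfold ginibreWeight
  rw [ginibreHamiltonian_shear_of_supported hJ, ginibreHamiltonian_leaf_shear hfoot hD]

omit [DecidableEq V] in
/-- A block Hamiltonian depends only on the block coordinates. [folklore] -/
private theorem ginibreWeight_dependsOn (hJ : ∀ p, J p ≠ 0 → p.1 ∈ L ∧ p.2 ∈ L) (θ θ' : V → Circle)
    (h : ∀ v ∈ L, θ v = θ' v) :
    ginibreWeight (pairChars V) J θ = ginibreWeight (pairChars V) J θ' := by
  unfold ginibreWeight ginibreHamiltonian
  congr 1
  refine Finset.sum_congr rfl fun p _ => ?_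
  by_cases hJp : J p = 0
  · rw [hJp, zero_mul, zero_mul]
  rw [pairChars_apply, reChar, reChar, diffChar_apply, diffChar_apply, h _ (hJ p hJp).1, h _ (hJ p hJp).2]

/-- The leaf field depends only on the coordinates off the block. [folklore] -/
private theorem leafField_dependsOn (hfoot : ∀ v, v ∉ L → foot v ∈ L)
    (hD : ∀ p, D p ≠ 0 → (p.1 ∉ L ∧ p.2 = foot p.1) ∨ (p.2 ∉ L ∧ p.1 = foot p.2)) (θ θ' : V → Circle)
    (h : ∀ v ∉ L, θ v = θ' v) : leafField L D θ = leafField L D θ' := by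
  unfold leafField
  refine Finset.sum_congr rfl fun p _ => ?_
  by_cases hDp : D p = 0
  · rw [hDp, zero_mul, zero_mul]
  have hl : leafOf L p ∉ L := by
    rcases hD p hDp with ⟨h1, h2⟩ | ⟨h2, h1⟩
    · rwa [leafOf, if_pos (h2 ▸ hfoot _ h1)]
    · rwa [leafOf, if_neg h2]
  rw [h _ hl]

/-- The leaf field is even under inversion of the torus (`cos` is even). [folklore] -/
private theorem leafField_inv (θ : V → Circle) : leafField L D θ⁻¹ = leafField L D θ := by
  unfold leafField
  refine Finset.sum_congr rfl fun p _ => ?_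
  rw [Pi.inv_apply, Circle.coe_inv_eq_conj, Complex.conj_re]

variable [MeasurableSpace Circle] [BorelSpace Circle]

/-- **The leaf sine integrates to zero**: `∫ Im θ_v · e^{leafField} dθ = 0` (inversion symmetry of the torus: the
leaf field is even, `Im θ_v` is odd). [folklore] -/
private theorem integral_im_mul_exp_leafField (v : V) :
    ∫ θ, ((θ v : Circle) : ℂ).im * Real.exp (leafField L D θ) ∂torusHaar V = 0 := by
  set G : (V → Circle) → ℝ := fun θ => ((θ v : Circle) : ℂ).im * Real.exp (leafField L D θ) with hG
  have hGc : Continuous G := by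
    simp only [hG, leafField]
    fun_prop
  have hodd : ∀ θ : V → Circle, G θ⁻¹ = -G θ := fun θ => by
    simp only [hG, leafField_inv, Pi.inv_apply, Circle.coe_inv_eq_conj, Complex.conj_im, neg_mul]
  have h := integral_comp_inv (V := V) hGc
  simp_rw [hodd, integral_neg] at h
  show ∫ θ, G θ ∂torusHaar V = 0
  linarith

/-- **The leaf cosine averages to the two-spin value**:
`∫ Re θ_v · e^{leafField} dθ = u(K_v) · ∫ e^{leafField} dθ`, `u = I₁/I₀`, `K_v` the dangling coupling at `v`
(Fubini over the sites: the leaf-field weight is the product `∏_w e^{K_w cos θ_w}`, and the two Fourier coefficients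
of `e^{K cos θ}` are `I₀(K)`, `I₁(K)`). [cite: Lieb1980, eq. (25) (two-spin system, I₁(β)/I₀(β))] -/
private theorem integral_re_mul_exp_leafField (v : V) :
    ∫ θ, ((θ v : Circle) : ℂ).re * Real.exp (leafField L D θ) ∂torusHaar V =
      besselRatio (leafCoupling L D v) * ∫ θ, Real.exp (leafField L D θ) ∂torusHaar V := by
  classical
  set K : V → ℝ := leafCoupling L D with hK
  set g : V → Circle → ℝ := fun w z => Real.exp (K w * (z : ℂ).re) with hg
  set g' : V → Circle → ℝ := fun w z => if w = v then (z : ℂ).re * g w z else g w z with hg'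
  have hgc : ∀ w, Continuous (g w) := fun w => by
    simp only [hg]
    exact Real.continuous_exp.comp (continuous_const.mul (Complex.continuous_re.comp continuous_subtype_val))
  have hg'c : ∀ w, Continuous (g' w) := fun w => by
    by_cases hw : w = v
    · simp only [hg', hw, if_true]
      exact (Complex.continuous_re.comp continuous_subtype_val).mul (hgc v)
    · simp only [hg', hw, if_false]; exact hgc w
  -- the leaf-field weight is a product of one-site weights
  have hE : ∀ θ : V → Circle, Real.exp (leafField L D θ) = ∏ w, g w (θ w) := fun θ => by
    rw [leafField_eq_sum_leafCoupling, Real.exp_sum]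
  have hO : ∀ θ : V → Circle, ((θ v : Circle) : ℂ).re * Real.exp (leafField L D θ) = ∏ w, g' w (θ w) := by
    intro θ
    rw [hE, ← Finset.mul_prod_erase Finset.univ (fun w => g' w (θ w)) (Finset.mem_univ v),
      ← Finset.mul_prod_erase Finset.univ (fun w => g w (θ w)) (Finset.mem_univ v)]
    have h1 : ∏ w ∈ Finset.univ.erase v, g' w (θ w) = ∏ w ∈ Finset.univ.erase v, g w (θ w) :=
      Finset.prod_congr rfl fun w hw => by simp only [hg', if_neg (Finset.ne_of_mem_erase hw)]
    rw [h1]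
    simp only [hg', if_pos rfl]
    ring
  have hN : ∫ θ, ((θ v : Circle) : ℂ).re * Real.exp (leafField L D θ) ∂torusHaar V =
      ∏ w, ∫ z, g' w z ∂Measure.haarMeasure (⊤ : TopologicalSpace.PositiveCompacts Circle) := by
    simp_rw [hO]
    exact integral_fintype_prod_eq_prod (𝕜 := ℝ) g'
  have hZ : ∫ θ, Real.exp (leafField L D θ) ∂torusHaar V =
      ∏ w, ∫ z, g w z ∂Measure.haarMeasure (⊤ : TopologicalSpace.PositiveCompacts Circle) := by
    simp_rw [hE]
    exact integral_fintype_prod_eq_prod (𝕜 := ℝ) g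
  have hrest : ∏ w ∈ Finset.univ.erase v, ∫ z, g' w z ∂Measure.haarMeasure (⊤ : TopologicalSpace.PositiveCompacts Circle) =
      ∏ w ∈ Finset.univ.erase v, ∫ z, g w z ∂Measure.haarMeasure (⊤ : TopologicalSpace.PositiveCompacts Circle) :=
    Finset.prod_congr rfl fun w hw => by simp only [hg', if_neg (Finset.ne_of_mem_erase hw)]
  have hgv : ∫ z, g v z ∂Measure.haarMeasure (⊤ : TopologicalSpace.PositiveCompacts Circle) = besselI 0 (K v) := by
    simp only [hg]
    exact integral_exp_mul_re_eq_besselI_zero _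
  have hg'v : ∫ z, g' v z ∂Measure.haarMeasure (⊤ : TopologicalSpace.PositiveCompacts Circle) = besselI 1 (K v) := by
    simp only [hg', hg, if_true]
    exact integral_re_mul_exp_mul_re_eq_besselI_one _
  have hI0 : besselI 0 (K v) ≠ 0 := by
    rw [← hgv]
    simp only [hg]
    have hc : Continuous fun z : Circle => Real.exp (K v * (z : ℂ).re) := by fun_prop
    exact (integral_exp_pos (integrable_of_continuous_of_isFiniteMeasure _ hc)).ne'
  rw [hN, hZ, ← Finset.mul_prod_erase _ _ (Finset.mem_univ v),
    ← Finset.mul_prod_erase Finset.univ (fun w => ∫ z, g w z ∂_) (Finset.mem_univ v), hrest, hgv, hg'v,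
    besselRatio, ← mul_assoc, div_mul_cancel₀ _ hI0]

/-- **The exact leaf-transfer identity.** Let the couplings `J` be supported in `L × L` (the block) and `D` on
dangling bonds — `D_p ≠ 0` only for `p = (foot v, v)` or `(v, foot v)` with `v ∉ L`, `foot v ∈ L`. Then for `a ∈ L`
and every leaf `v ∉ L`:

  `⟨cos(θ_a − θ_v)⟩_{J+D} = u(K_v) · ⟨cos(θ_a − θ_{foot v})⟩_J`,  `K_v = D(foot v, v) + D(v, foot v)`, `u = I₁/I₀`.

(A free rotator, `K_v = 0`, has `u(0) = 0`.) This is the equality case of the leaf bound `twoPoint_add_leaf_le`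
(`u(K) ≤ K/2`, Aizenman–Simon's local Ward inequality) and the block–leaf companion of `twoPoint_add_leaf_eq`: the
dangling end transmits correlations by the exact two-spin factor `I₁(K)/I₀(K)` of Lieb's proof of Theorem 4 ("the
two-spin system consisting of `a` and `b` alone"). Proof: shear `θ_v ↦ θ_vθ_{foot v}` (Haar-measure preserving),
`cos(θ_a − θ_v) ↦ cos(θ_a − θ_{fv})cos θ_v − sin(θ_a − θ_{fv}) sin θ_v`, independence of block and leaf
coordinates, `∫ sin θ_v e^{leaf field} = 0`, and `⟨cos θ_v⟩_{leaf field} = I₁(K_v)/I₀(K_v)`.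
[cite: Lieb1980, Theorem 4 and eq. (25) (two-spin system, I₁(β)/I₀(β)); Ginibre1970, Example 4 (plane rotators)] -/
theorem twoPoint_add_leaf_transfer (hfoot : ∀ v, v ∉ L → foot v ∈ L) (hJ : ∀ p, J p ≠ 0 → p.1 ∈ L ∧ p.2 ∈ L)
    (hD : ∀ p, D p ≠ 0 → (p.1 ∉ L ∧ p.2 = foot p.1) ∨ (p.2 ∉ L ∧ p.1 = foot p.2)) {a v : V} (ha : a ∈ L)
    (hv : v ∉ L) :
    twoPoint (J + D) a v = besselRatio (D (foot v, v) + D (v, foot v)) * twoPoint J a (foot v) := by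
  have hfv : foot v ∈ L := hfoot v hv
  have hwc : Continuous (ginibreWeight (pairChars V) J) := continuous_ginibreWeight _ _
  have hEc : Continuous fun θ : V → Circle => Real.exp (leafField L D θ) := by unfold leafField; fun_prop
  have hre : Continuous fun θ : V → Circle => ((θ v : Circle) : ℂ).re := by fun_prop
  have him : Continuous fun θ : V → Circle => ((θ v : Circle) : ℂ).im := by fun_prop
  have hwdep : ∀ θ θ' : V → Circle, (∀ x ∈ L, θ x = θ' x) →
      ginibreWeight (pairChars V) J θ = ginibreWeight (pairChars V) J θ' := ginibreWeight_dependsOn hJ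
  have hEdep : ∀ θ θ' : V → Circle, (∀ x ∉ L, θ x = θ' x) →
      Real.exp (leafField L D θ) = Real.exp (leafField L D θ') := fun θ θ' h => by
    rw [leafField_dependsOn hfoot hD θ θ' h]
  -- the denominator factorises
  have hZ : ∫ θ, ginibreWeight (pairChars V) (J + D) θ ∂torusHaar V =
      (∫ θ, ginibreWeight (pairChars V) J θ ∂torusHaar V) * ∫ θ, Real.exp (leafField L D θ) ∂torusHaar V := by
    rw [← integral_comp_shear hfoot (continuous_ginibreWeight _ _)]
    simp_rw [ginibreWeight_add_shear hfoot hJ hD]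
    exact integral_mul_eq_mul_of_dependsOn L hwc hEc hwdep hEdep
  -- the numerator factorises
  have hN : ∫ θ, cosDiff a v θ * ginibreWeight (pairChars V) (J + D) θ ∂torusHaar V =
      (∫ θ, cosDiff a (foot v) θ * ginibreWeight (pairChars V) J θ ∂torusHaar V) *
        (besselRatio (leafCoupling L D v) * ∫ θ, Real.exp (leafField L D θ) ∂torusHaar V) := by
    rw [← integral_comp_shear hfoot (g := fun θ => cosDiff a v θ * ginibreWeight (pairChars V) (J + D) θ)
      ((continuous_cosDiff a v).mul (continuous_ginibreWeight _ _))]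
    have hpt : ∀ θ : V → Circle,
        cosDiff a v (shear L foot θ) * ginibreWeight (pairChars V) (J + D) (shear L foot θ) =
          (cosDiff a (foot v) θ * ginibreWeight (pairChars V) J θ) *
              (((θ v : Circle) : ℂ).re * Real.exp (leafField L D θ)) -
            (sinDiff a (foot v) θ * ginibreWeight (pairChars V) J θ) *
              (((θ v : Circle) : ℂ).im * Real.exp (leafField L D θ)) := fun θ => by
      rw [ginibreWeight_add_shear hfoot hJ hD, cosDiff_shear_leaf θ ha hv]
      ring
    simp_rw [hpt]
    have hc1 : Continuous fun θ : V → Circle => cosDiff a (foot v) θ * ginibreWeight (pairChars V) J θ :=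
      (continuous_cosDiff a _).mul hwc
    have hs1 : Continuous fun θ : V → Circle => sinDiff a (foot v) θ * ginibreWeight (pairChars V) J θ :=
      (continuous_sinDiff a _).mul hwc
    have hre' : Continuous fun θ : V → Circle => ((θ v : Circle) : ℂ).re * Real.exp (leafField L D θ) :=
      hre.mul hEc
    have him' : Continuous fun θ : V → Circle => ((θ v : Circle) : ℂ).im * Real.exp (leafField L D θ) :=
      him.mul hEc
    have hi1 : Integrable (fun θ : V → Circle => (cosDiff a (foot v) θ * ginibreWeight (pairChars V) J θ) *
        (((θ v : Circle) : ℂ).re * Real.exp (leafField L D θ))) (torusHaar V) :=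
      integrable_torusHaar_of_continuous (hc1.mul hre')
    have hi2 : Integrable (fun θ : V → Circle => (sinDiff a (foot v) θ * ginibreWeight (pairChars V) J θ) *
        (((θ v : Circle) : ℂ).im * Real.exp (leafField L D θ))) (torusHaar V) :=
      integrable_torusHaar_of_continuous (hs1.mul him')
    rw [integral_sub hi1 hi2,
      integral_mul_eq_mul_of_dependsOn L hc1 hre'
        (fun θ θ' h => by rw [cosDiff, cosDiff, h a ha, h _ hfv, hwdep θ θ' h])
        (fun θ θ' h => by rw [h v hv, hEdep θ θ' h]),
      integral_mul_eq_mul_of_dependsOn L hs1 him'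
        (fun θ θ' h => by rw [sinDiff, sinDiff, h a ha, h _ hfv, hwdep θ θ' h])
        (fun θ θ' h => by rw [h v hv, hEdep θ θ' h]),
      integral_im_mul_exp_leafField v, mul_zero, sub_zero, integral_re_mul_exp_leafField v]
  have hEpos : 0 < ∫ θ, Real.exp (leafField L D θ) ∂torusHaar V :=
    integral_exp_pos (integrable_torusHaar_of_continuous hEc)
  unfold twoPoint ginibreExpect
  rw [hN, hZ, leafCoupling_eq hfoot hD hv, ← mul_assoc, mul_div_mul_right _ _ hEpos.ne', mul_comm, mul_div_assoc]

/-- The leaf-transfer identity with the leaf as first argument: `⟨cos(θ_v − θ_a)⟩_{J+D} = u(K_v)⟨cos(θ_{fv} − θ_a)⟩_J`.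
[cite: Lieb1980, Theorem 4 and eq. (25) (two-spin system, I₁(β)/I₀(β))] -/
theorem twoPoint_add_leaf_transfer' (hfoot : ∀ v, v ∉ L → foot v ∈ L) (hJ : ∀ p, J p ≠ 0 → p.1 ∈ L ∧ p.2 ∈ L)
    (hD : ∀ p, D p ≠ 0 → (p.1 ∉ L ∧ p.2 = foot p.1) ∨ (p.2 ∉ L ∧ p.1 = foot p.2)) {a v : V} (ha : a ∈ L)
    (hv : v ∉ L) :
    twoPoint (J + D) v a = besselRatio (D (foot v, v) + D (v, foot v)) * twoPoint J (foot v) a := by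
  rw [twoPoint_comm, twoPoint_add_leaf_transfer hfoot hJ hD ha hv, twoPoint_comm]

end LeafTransfer

/-! ### Boxes in `ℤ^ν`: the foot map of the reference box, and Lieb's reduction to the block -/

section BoxBlock

open Literature.Barriers.CriticalPhenomena Literature.Barriers.CriticalPhenomena.LongRangeIsing

variable {ν : ℕ}

/-- **The foot map of the box of radius `R + 1`**: coordinates of absolute value `> R` (i.e. `±(R+1)` on the box)
are pulled in to `±R`; sites of the block `[−R, R]^ν` are fixed. [cite: Lieb1980, p. 128 (B the boundary of a box)] -/
def pullIn (R : ℕ) (y : Site ν) : Site ν := fun i => if (y i).natAbs ≤ R then y i else Int.sign (y i) * R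

omit ν in
/-- `pullIn R y ∈ [−R, R]^ν` for every `y`. [cite: Lieb1980, p. 128 (boxes: B the boundary of a box)] -/
theorem pullIn_mem_box {ν : ℕ} (R : ℕ) (y : Site ν) : pullIn R y ∈ box ν R := by
  rw [mem_box]
  intro i
  simp only [pullIn]
  split_ifs with h
  · omega
  · rcases lt_trichotomy (y i) 0 with hlt | heq | hgt
    · rw [Int.sign_eq_neg_one_of_neg hlt]; omega
    · rw [heq, Int.sign_zero]; omega
    · rw [Int.sign_eq_one_of_pos hgt]; omega

omit ν in
/-- The block is fixed by the foot map: `‖y‖_∞ ≤ R ⇒ pullIn R y = y`. [cite: Lieb1980, p. 128 (boxes: B the boundary of a box)] -/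
theorem pullIn_of_supNorm_le {ν : ℕ} {R : ℕ} {y : Site ν} (h : Site.supNorm y ≤ R) : pullIn R y = y := by
  funext i
  simp only [pullIn]
  rw [if_pos ((Site.natAbs_le_supNorm y i).trans h)]

omit ν in
/-- **A shell site with a nearest neighbour in the block hangs on its foot**: if `‖x‖_∞ ≤ R`, `‖y‖_∞ = R + 1` and
`‖x − y‖₁ = 1` then `x = pullIn R y` (the differing coordinate is the one of modulus `R + 1`, pulled in by one).
[cite: Lieb1980, p. 128 (B the boundary of a box)] -/
theorem eq_pullIn_of_l1Norm_eq_one {ν : ℕ} {R : ℕ} {x y : Site ν} (hx : Site.supNorm x ≤ R)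
    (hy : Site.supNorm y = R + 1) (hxy : l1Norm (x - y) = 1) : x = pullIn R y := by
  classical
  -- some coordinate of `y` has modulus `R + 1`
  have hd : (Finset.univ : Finset (Fin ν)).Nonempty := by
    by_contra h
    rw [Finset.not_nonempty_iff_eq_empty] at h
    have h0 : Site.supNorm y = 0 := by
      unfold Site.supNorm; rw [h, Finset.sup_empty]; rfl
    omega
  obtain ⟨j, hj⟩ := Site.exists_natAbs_eq_supNorm hd y
  rw [hy] at hj
  have hxj : (x j).natAbs ≤ R := (Site.natAbs_le_supNorm x j).trans hx
  -- every coordinate difference is at most one, and the `j`-th is exactly one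
  have hle : ∀ i, (x i - y i).natAbs ≤ 1 := fun i => by
    have h := Finset.single_le_sum (f := fun i => ((x - y) i).natAbs) (fun _ _ => Nat.zero_le _)
      (Finset.mem_univ i)
    simp only [Pi.sub_apply] at h
    unfold l1Norm at hxy
    simp only [Pi.sub_apply] at hxy
    omega
  have hj1 : (x j - y j).natAbs = 1 := by
    have := hle j
    omega
  -- the other coordinate differences vanish
  have hrest : ∀ i, i ≠ j → x i = y i := by
    intro i hij
    unfold l1Norm at hxy
    rw [← Finset.add_sum_erase _ _ (Finset.mem_univ j)] at hxy
    simp only [Pi.sub_apply] at hxy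
    rw [hj1] at hxy
    have h0 : ∑ k ∈ Finset.univ.erase j, (x k - y k).natAbs = 0 := by omega
    have hk := (Finset.sum_eq_zero_iff.1 h0) i (Finset.mem_erase.2 ⟨hij, Finset.mem_univ i⟩)
    omega
  funext i
  by_cases hij : i = j
  · subst hij
    simp only [pullIn]
    rw [if_neg (by omega)]
    rcases lt_trichotomy (y i) 0 with hlt | heq | hgt
    · rw [Int.sign_eq_neg_one_of_neg hlt]; omega
    · omega
    · rw [Int.sign_eq_one_of_pos hgt]; omega
  · simp only [pullIn]
    rw [← hrest i hij, if_pos ((Site.natAbs_le_supNorm x i).trans hx)]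

/-- The foot map as a map from the reference box of radius `R + 1` to the block `box ν R`.
[cite: Lieb1980, p. 128 (B the boundary of a box)] -/
def footIn (R : ℕ) (b : box ν (R + 1)) : box ν R := ⟨pullIn R (b : Site ν), pullIn_mem_box R _⟩

/-- The embedding of the block `box ν R` into the reference box `box ν (R + 1)` (its interior `‖·‖_∞ ≤ R`).
[cite: Lieb1980, p. 128 (boxes)] -/
def blockEmb (R : ℕ) (x : box ν R) : box ν (R + 1) := ⟨(x : Site ν), box_mono ν (Nat.le_succ R) x.2⟩

omit ν in
/-- `blockEmb` is injective. [folklore] -/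
private theorem blockEmb_injective {ν : ℕ} (R : ℕ) : Function.Injective (blockEmb (ν := ν) R) :=
  fun _ _ h => Subtype.ext (congrArg Subtype.val h :)

omit ν in
/-- Block sites have `‖·‖_∞ ≤ R`. [cite: Lieb1980, p. 128 (boxes)] -/
theorem supNorm_blockEmb_le {ν : ℕ} {R : ℕ} (x : box ν R) : Site.supNorm ((blockEmb R x : box ν (R + 1)) : Site ν) ≤ R :=
  mem_box_iff_supNorm_le.1 x.2

omit ν in
/-- The foot of a block site is itself. [cite: Lieb1980, p. 128 (boxes: B the boundary of a box)] -/
theorem footIn_blockEmb {ν : ℕ} {R : ℕ} (x : box ν R) : footIn R (blockEmb R x) = x :=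
  Subtype.ext (pullIn_of_supNorm_le (mem_box_iff_supNorm_le.1 x.2))

omit ν in
/-- An interior site of the reference box is the image of its foot. [cite: Lieb1980, p. 128 (boxes: B the boundary of a box)] -/
theorem blockEmb_footIn {ν : ℕ} {R : ℕ} {b : box ν (R + 1)} (hb : Site.supNorm (b : Site ν) ≤ R) :
    blockEmb R (footIn R b) = b :=
  Subtype.ext (pullIn_of_supNorm_le hb)

omit ν in
/-- The centre of the reference box is the image of the centre of the block. [cite: Lieb1980, p. 128 (boxes)] -/
theorem blockEmb_refCentre {ν : ℕ} (R : ℕ) : blockEmb R (refCentre ν R) = refCentre ν (R + 1) :=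
  Subtype.ext rfl

omit ν in
/-- In the reference box of radius `R + 1`, a site is NOT in the interior iff it is on the shell. [folklore] -/
private theorem not_le_iff_eq_succ {ν : ℕ} {R : ℕ} (b : box ν (R + 1)) :
    ¬ Site.supNorm (b : Site ν) ≤ R ↔ Site.supNorm (b : Site ν) = R + 1 := by
  have hb : Site.supNorm (b : Site ν) ≤ R + 1 := mem_box_iff_supNorm_le.1 b.2
  omega

/-- The BLOCK part of the reference couplings: the bonds with both endpoints in the interior `‖·‖_∞ ≤ R`.
[cite: Lieb1980, eqs. (4)–(5) and p. 128 (boxes)] -/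
def blockCoupling (Jf : Site ν → Site ν → ℝ) (R : ℕ) (p : box ν (R + 1) × box ν (R + 1)) : ℝ :=
  if Site.supNorm (p.1 : Site ν) ≤ R ∧ Site.supNorm (p.2 : Site ν) ≤ R then Jf p.1 p.2 else 0

/-- The DANGLING part of the reference couplings: the bonds between the interior and the shell.
[cite: Lieb1980, eqs. (4)–(5) and p. 133 (B–B interactions part of H_C)] -/
def danglingCoupling (Jf : Site ν → Site ν → ℝ) (R : ℕ) (p : box ν (R + 1) × box ν (R + 1)) : ℝ :=
  if (Site.supNorm (p.1 : Site ν) ≤ R ∧ Site.supNorm (p.2 : Site ν) = R + 1) ∨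
      (Site.supNorm (p.1 : Site ν) = R + 1 ∧ Site.supNorm (p.2 : Site ν) ≤ R) then Jf p.1 p.2 else 0

omit ν in
/-- **The reference inside system of the box is the block plus dangling bonds** (shell–shell bonds are absent).
[cite: Lieb1980, eqs. (4)–(5) and p. 133 (B–B interactions part of H_C)] -/
theorem refCoupling_succ_eq_add {ν : ℕ} (Jf : Site ν → Site ν → ℝ) (R : ℕ) :
    refCoupling Jf (R + 1) = blockCoupling Jf R + danglingCoupling Jf R := by
  funext p
  simp only [Pi.add_apply, refCoupling, blockCoupling, danglingCoupling]
  have h1 := not_le_iff_eq_succ (R := R) p.1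
  have h2 := not_le_iff_eq_succ (R := R) p.2
  by_cases ha : Site.supNorm (p.1 : Site ν) ≤ R <;> by_cases hb : Site.supNorm (p.2 : Site ν) ≤ R
  · rw [if_neg (fun h => absurd h.1 (by omega)), if_pos ⟨ha, hb⟩, if_neg (by omega), add_zero]
  · rw [if_neg (fun h => absurd h.1 (by omega)), if_neg (fun h => hb h.2), if_pos (Or.inl ⟨ha, h2.1 hb⟩), zero_add]
  · rw [if_neg (fun h => absurd h.2 (by omega)), if_neg (fun h => ha h.1), if_pos (Or.inr ⟨h1.1 ha, hb⟩), zero_add]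
  · rw [if_pos ⟨h1.1 ha, h2.1 hb⟩, if_neg (fun h => ha h.1), if_neg (by omega), add_zero]

omit ν in
/-- The block couplings are supported in the interior. [cite: Lieb1980, eqs. (4)–(5) and p. 128 (boxes)] -/
theorem blockCoupling_support {ν : ℕ} (Jf : Site ν → Site ν → ℝ) (R : ℕ) (p : box ν (R + 1) × box ν (R + 1))
    (hp : blockCoupling Jf R p ≠ 0) :
    p.1 ∈ Finset.univ.filter (fun b : box ν (R + 1) => Site.supNorm (b : Site ν) ≤ R) ∧
      p.2 ∈ Finset.univ.filter (fun b : box ν (R + 1) => Site.supNorm (b : Site ν) ≤ R) := by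
  unfold blockCoupling at hp
  by_cases h : Site.supNorm (p.1 : Site ν) ≤ R ∧ Site.supNorm (p.2 : Site ν) ≤ R
  · exact ⟨Finset.mem_filter.2 ⟨Finset.mem_univ _, h.1⟩, Finset.mem_filter.2 ⟨Finset.mem_univ _, h.2⟩⟩
  · exact absurd (if_neg h) hp

omit ν in
/-- **Nearest-neighbour dangling bonds hang on feet**: if `Jf` is supported on `ℓ¹`-nearest neighbours, every
dangling bond of the reference box joins a shell site `v` to `pullIn R v`. [cite: Lieb1980, p. 128 (B the boundary of a box)] -/
theorem danglingCoupling_support {ν : ℕ} {Jf : Site ν → Site ν → ℝ} (hJf : ∀ x y, Jf x y ≠ 0 → l1Norm (x - y) = 1)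
    (R : ℕ) (p : box ν (R + 1) × box ν (R + 1)) (hp : danglingCoupling Jf R p ≠ 0) :
    (p.1 ∉ Finset.univ.filter (fun b : box ν (R + 1) => Site.supNorm (b : Site ν) ≤ R) ∧
        p.2 = blockEmb R (footIn R p.1)) ∨
      (p.2 ∉ Finset.univ.filter (fun b : box ν (R + 1) => Site.supNorm (b : Site ν) ≤ R) ∧
        p.1 = blockEmb R (footIn R p.2)) := by
  unfold danglingCoupling at hp
  by_cases h : (Site.supNorm (p.1 : Site ν) ≤ R ∧ Site.supNorm (p.2 : Site ν) = R + 1) ∨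
      (Site.supNorm (p.1 : Site ν) = R + 1 ∧ Site.supNorm (p.2 : Site ν) ≤ R)
  · rw [if_pos h] at hp
    have h1 := hJf _ _ hp
    rcases h with ⟨ha, hb⟩ | ⟨ha, hb⟩
    · refine Or.inr ⟨fun hm => ?_, Subtype.ext (eq_pullIn_of_l1Norm_eq_one ha hb h1)⟩
      have := (Finset.mem_filter.1 hm).2
      omega
    · refine Or.inl ⟨fun hm => ?_, Subtype.ext (eq_pullIn_of_l1Norm_eq_one hb ha (by rwa [l1Norm_sub_comm]))⟩
      have := (Finset.mem_filter.1 hm).2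
      omega
  · exact absurd (if_neg h) hp

omit ν in
/-- The block couplings of the reference box are the zero extension, along `blockEmb`, of the couplings of the
free block `box ν R`. [cite: Lieb1980, eqs. (4)–(5) and p. 128 (boxes)] -/
theorem blockCoupling_eq_extendCoupling {ν : ℕ} (Jf : Site ν → Site ν → ℝ) (R : ℕ) :
    blockCoupling Jf R = extendCoupling (blockEmb R) (fun q : box ν R × box ν R => Jf q.1 q.2) := by
  classical
  funext p
  unfold extendCoupling
  by_cases h : Site.supNorm (p.1 : Site ν) ≤ R ∧ Site.supNorm (p.2 : Site ν) ≤ R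
  · have hp : p = Prod.map (blockEmb R) (blockEmb R) (footIn R p.1, footIn R p.2) := by
      ext1
      · exact (blockEmb_footIn h.1).symm
      · exact (blockEmb_footIn h.2).symm
    rw [hp, ((blockEmb_injective R).prodMap (blockEmb_injective R)).extend_apply, ← hp]
    simp only [blockCoupling, if_pos h]
    show Jf (p.1 : Site ν) (p.2 : Site ν) = Jf (pullIn R (p.1 : Site ν)) (pullIn R (p.2 : Site ν))
    rw [pullIn_of_supNorm_le h.1, pullIn_of_supNorm_le h.2]
  · have hnot : ¬ ∃ q, Prod.map (blockEmb R) (blockEmb R) q = p := by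
      rintro ⟨q, rfl⟩
      exact h ⟨supNorm_blockEmb_le _, supNorm_blockEmb_le _⟩
    rw [Function.extend_apply' _ _ _ hnot]
    simp only [blockCoupling, Pi.zero_apply]
    exact if_neg h

variable [MeasurableSpace Circle] [BorelSpace Circle]

/-- **Block correlations of the reference box are those of the free block.** For `Jf` supported on nearest
neighbours, between interior sites the two-point function of the reference inside system of the box of radius
`R + 1` is the two-point function of the free block `[−R, R]^ν`: the shell leaves integrate out
(`twoPoint_add_leaf_eq`). [cite: Lieb1980, p. 128 and p. 133 (boxes; B–B interactions part of H_C); Ginibre1970, Example 4 (plane rotators)] -/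
theorem twoPoint_refCoupling_blockEmb {Jf : Site ν → Site ν → ℝ} (hJf : ∀ x y, Jf x y ≠ 0 → l1Norm (x - y) = 1)
    (R : ℕ) (x y : box ν R) :
    twoPoint (refCoupling Jf (R + 1)) (blockEmb R x) (blockEmb R y) =
      twoPoint (fun q : box ν R × box ν R => Jf q.1 q.2) x y := by
  classical
  rw [refCoupling_succ_eq_add,
    twoPoint_add_leaf_eq (L := Finset.univ.filter (fun b : box ν (R + 1) => Site.supNorm (b : Site ν) ≤ R))
      (foot := fun b => blockEmb R (footIn R b))
      (fun v _ => Finset.mem_filter.2 ⟨Finset.mem_univ _, supNorm_blockEmb_le _⟩)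
      (blockCoupling_support Jf R) (danglingCoupling_support hJf R)
      (Finset.mem_filter.2 ⟨Finset.mem_univ _, supNorm_blockEmb_le _⟩)
      (Finset.mem_filter.2 ⟨Finset.mem_univ _, supNorm_blockEmb_le _⟩),
    blockCoupling_eq_extendCoupling, twoPoint_extend_eq (blockEmb_injective R)]

/-- **A shell site transfers by the two-spin factor of its foot bond.** For `Jf` supported on nearest neighbours,
`x` in the block and `b` on the shell of the reference box of radius `R + 1`:
`⟨cos(θ_x − θ_b)⟩_{box, shell free} = u(K_b) · ⟨cos(θ_x − θ_{foot b})⟩_{free block}`,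
`K_b = Jf(foot b, b) + Jf(b, foot b)` (`= 0`, hence the term vanishes, unless `b` is on a face).
[cite: Lieb1980, Theorem 4 and eq. (25), p. 128 (boxes; two-spin system I₁(β)/I₀(β))] -/
theorem twoPoint_refCoupling_shell {Jf : Site ν → Site ν → ℝ} (hJf : ∀ x y, Jf x y ≠ 0 → l1Norm (x - y) = 1)
    (R : ℕ) (x : box ν R) {b : box ν (R + 1)} (hb : Site.supNorm (b : Site ν) = R + 1) :
    twoPoint (refCoupling Jf (R + 1)) (blockEmb R x) b =
      besselRatio (Jf (pullIn R b) b + Jf b (pullIn R b)) *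
        twoPoint (fun q : box ν R × box ν R => Jf q.1 q.2) x (footIn R b) := by
  classical
  have hbL : b ∉ Finset.univ.filter (fun b : box ν (R + 1) => Site.supNorm (b : Site ν) ≤ R) := fun h => by
    have := (Finset.mem_filter.1 h).2; omega
  rw [refCoupling_succ_eq_add,
    twoPoint_add_leaf_transfer (L := Finset.univ.filter (fun b : box ν (R + 1) => Site.supNorm (b : Site ν) ≤ R))
      (foot := fun b => blockEmb R (footIn R b))
      (fun v _ => Finset.mem_filter.2 ⟨Finset.mem_univ _, supNorm_blockEmb_le _⟩)
      (blockCoupling_support Jf R) (danglingCoupling_support hJf R)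
      (Finset.mem_filter.2 ⟨Finset.mem_univ _, supNorm_blockEmb_le _⟩) hbL,
    blockCoupling_eq_extendCoupling, twoPoint_extend_eq (blockEmb_injective R)]
  congr 2
  have hfoot : Site.supNorm (pullIn R (b : Site ν)) ≤ R := mem_box_iff_supNorm_le.1 (pullIn_mem_box R _)
  simp only [danglingCoupling, blockEmb, footIn]
  rw [if_pos (Or.inl ⟨hfoot, hb⟩), if_pos (Or.inr ⟨hb, hfoot⟩)]

/-- **Lieb's number of the box of radius `R + 1` from the free block of radius `R`** (general nearest-neighbour
couplings `Jf`, translation invariance not needed):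
`S_{R+1} = ∑_{‖b‖_∞ = R+1} u(Jf(foot b, b) + Jf(b, foot b)) · ⟨cos(θ_0 − θ_{foot b})⟩_{[−R,R]^ν, free}`.
[cite: Lieb1980, Theorem 4 and p. 128 (boxes; finite algorithm)] -/
theorem boxShellSum_succ_eq {Jf : Site ν → Site ν → ℝ} (hJf : ∀ x y, Jf x y ≠ 0 → l1Norm (x - y) = 1) (R : ℕ) :
    boxShellSum Jf (R + 1) = ∑ b ∈ refShell ν (R + 1),
      besselRatio (Jf (pullIn R b) b + Jf b (pullIn R b)) *
        twoPoint (fun q : box ν R × box ν R => Jf q.1 q.2) (refCentre ν R) (footIn R b) := by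
  unfold boxShellSum
  refine Finset.sum_congr rfl fun b hb => ?_
  rw [← blockEmb_refCentre, twoPoint_refCoupling_shell hJf R _ (Finset.mem_filter.1 hb).2]

omit ν [MeasurableSpace Circle] [BorelSpace Circle] in
/-- `nnCoupling` is supported on `ℓ¹`-nearest neighbours. [folklore] -/
private theorem nn_support {ν : ℕ} (K : ℝ) (x y : Site ν) (h : K / 2 * nnCoupling ν x y ≠ 0) : l1Norm (x - y) = 1 := by
  by_contra h1
  exact h (by unfold nnCoupling; rw [if_neg h1, mul_zero])

/-- **Lieb's number of the nearest-neighbour XY model from the free block**: for every `K`, `ν` and `R`,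

  `S_{R+1}(K) = u(K) · ∑_{‖b‖_∞ = R+1, ‖foot b − b‖₁ = 1} ⟨cos(θ_0 − θ_{foot b})⟩_{Λ_R, K}`,

where the two-point functions are those of the nearest-neighbour XY model on the finite box `Λ_R = box ν R` with
free boundary conditions (`nnXYCoupling K ν (box ν R)`) and the sum runs over the FACE sites of the shell (those
with a nearest neighbour in the block; edge and corner sites are free rotators and drop out, `u(0) = 0`). For
`ν = 2`, `R + 1 = 2` this is `S_2(K) = u(K)(4G_e + 8G_c)` (twelve face sites hanging on the boundary of the
`3 × 3` block: edge midpoints once, corners twice). The INPUT of the kernel criterion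
`twoPoint_nn_le_pow_boxShellSum` is thereby a finite sum of two-point functions of ONE free block.
[cite: Lieb1980, Theorem 4 and p. 128 (boxes; finite algorithm)] -/
theorem nnBoxShellSum_succ (K : ℝ) (ν R : ℕ) :
    nnBoxShellSum K ν (R + 1) = besselRatio K *
      ∑ b ∈ (refShell ν (R + 1)).filter (fun b : box ν (R + 1) => l1Norm (pullIn R (b : Site ν) - (b : Site ν)) = 1),
        twoPoint (nnXYCoupling K ν (box ν R)) (refCentre ν R) (footIn R b) := by
  unfold nnBoxShellSum
  rw [boxShellSum_succ_eq (nn_support K) R, Finset.mul_sum, Finset.sum_filter]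
  refine Finset.sum_congr rfl fun b _ => ?_
  have hJ : (fun q : box ν R × box ν R => K / 2 * nnCoupling ν (q.1 : Site ν) (q.2 : Site ν)) =
      nnXYCoupling K ν (box ν R) := rfl
  rw [hJ]
  unfold nnCoupling
  rw [l1Norm_sub_comm (b : Site ν) (pullIn R (b : Site ν))]
  split_ifs with h
  · congr 1; ring_nf
  · rw [mul_zero, add_zero, besselRatio_zero, zero_mul]

/-- **The interior susceptibility of the reference box is the susceptibility of the centre in the free block**:
`χ^{int}_{R+1}(K) = ∑_{x ∈ Λ_R} ⟨cos(θ_0 − θ_x)⟩_{Λ_R, K}`, `Λ_R = box 2 R` with free boundary conditions — the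
second input of `slabShellSum_le_box2D` / `twoPoint_layered_le_pow_box2D`. [cite: Lieb1980, p. 128 (boxes); Ginibre1970, Example 4 (plane rotators; free ends)] -/
theorem boxInteriorSum_succ (K : ℝ) (R : ℕ) :
    boxInteriorSum K (R + 1) = ∑ x : box 2 R, twoPoint (nnXYCoupling K 2 (box 2 R)) (refCentre 2 R) x := by
  unfold boxInteriorSum
  refine Finset.sum_nbij' (footIn R) (blockEmb R) (fun _ _ => Finset.mem_univ _)
    (fun x _ => Finset.mem_filter.2 ⟨Finset.mem_univ _, Nat.lt_succ_of_le (supNorm_blockEmb_le x)⟩)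
    (fun y hy => blockEmb_footIn (Nat.le_of_lt_succ (Finset.mem_filter.1 hy).2))
    (fun x _ => footIn_blockEmb x) fun y hy => ?_
  have hyR : Site.supNorm (y : Site 2) ≤ R := Nat.le_of_lt_succ (Finset.mem_filter.1 hy).2
  have h := twoPoint_refCoupling_blockEmb (nn_support K) R (refCentre 2 R) (footIn R y)
  rw [blockEmb_footIn hyR, blockEmb_refCentre] at h
  exact h

end BoxBlock

end PlaneRotator

end Literature.Probability.LatticeModels

end
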